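import Summits.BirchSwinnertonDyer.BirchSwinnertonDyer.Theorems.AlignedTransportAtTwoOffStratumPartitionTwistFamilyZhaiExplicit
import HarnessLib

/-!
# Route `AlignedTransportAtTwo`, crux C2 `MainConjectureOfRankZeroBSDAtTwo` (stmt-22298), line `birth` — THE ZHAI SUB-FAMILY AT ODD LEVEL:
# Zhai's standing assumption «the Manin constant is odd» DISCHARGED BY PRINT (Abbes–Ullmo 1996 Thm. A: `p ∤ N ⟹ p ∤ c`) for every seed of odd
# conductor — so the rows of `…TwistFamilyZhai` / `…ZhaiSplit` / `…ZhaiExplicit` display only {optimality datum, `ord₂ L^{alg}(S) = 0`}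

HONEST FRAMING (cell `bsd-f1-sign2`, WIDTH-5 attach seat `bsd-line-att-p4` g23; `--supports stmt-BirchSwinnertonDyer-22298 --as helper`).
THEOREMS ONLY (no `def`, no named fact, no `sorry`). BSD is NOT proved; C1/C2/C3′ are NOT closed; nothing is asserted — every statement is
CONDITIONAL on the displayed PRINT named facts (hypotheses) and the seed's displayed data.

WHY. The three parents carry Zhai's arXiv-v2 standing assumption as the binder `hν : ¬ 2 ∣ Dt.c` (odd Manin constant of the optimality datum).
Zhai himself (v2 l. 263): «Abbes–Ullmo have proven this assumption whenever `C_E` is an odd integer». The tree holds Abbes–Ullmo's Theorem A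
as the named fact `ModularForms.abbesUllmo_not_dvd_maninConstant_of_not_dvd_level` (statement only: for an optimality datum at level `N'`
and a prime `p ∤ N'`, `p ∤ c`), whose optimality binder is `Zhai2021.IsOptimalDatum` VERBATIM and whose `maninConstant` is `Dt.c` by
definition. All five small certified seeds have ODD conductor (`1727`, `2071`, `4087`, `4087`, `2045`), so `hν` is discharged by print:

* §1 `not_two_dvd_c_of_abbesUllmo` (any `S` of odd conductor); the generic rows `bsdp_two_twist_zhaiFamily_of_certified_seed_oddLevel` (PRINT⁹ + cert
  + {optimality datum, `ord₂ L^{alg}(S) = 0`}) and `bsdp_two_twist_zhaiSplit_of_print_oddLevel` (PRINT⁵ + `BSDp S 2` + the same two data).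
* §2 the five small seeds: `bsdp_two_twist_zhaiSplit_<seed>_oddLevel` — `BSD(W, 2)` for every minimal model of `S^{(M)}`, `M` Zhai-admissible with the
  bad primes split, modulo PRINT⁶ {Zhai 1.1, Zhai v2 1.2, Creutz–Miller 1.1, Abbes–Ullmo Thm. A, GZK, modularity} + displayed {`X₀(N_S)`-optimality
  datum `Dt` of `S`, `ord₂(L(S,1)/Ω_∞(S)) = 0`} — the two remaining displayed data are «`S` is the optimal curve of its isogeny class» and «`L^{alg}(S,1)`
  is odd» (LMFDB-level facts about the seed, not kernel-decided here).
* §3 the explicit members of `…ZhaiExplicit` with `hν` discharged: `bsdp_two_twist_1727a1_37_oddLevel`, `bsdp_two_twist_1727a1_93_oddLevel`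
  (BSD₂ IN PRINT, PRINT⁶ + the two data), `analyticRank_eq_zero_twist_1727a1_neg3_oddLevel` (`r_an = 0` IN PRINT, Zhai 1.1 + Abbes–Ullmo + the two data).

PARTITION CURRENCY (D-0171): unchanged; displayed seed data on T_Z reduced from three items to two. Beyond-print theorem: no. BSD is NOT proved.

References: [AbbesUllmo1996] Thm. A; [Zhai2016] Thm. 1.1 and arXiv v2 Thm. 1.2 (standing assumption ll. 255–267); [CreutzMiller2012] Thm. 1.1;
[Miller2011LMS] Def. 1.1; [CremonaAlgorithms1997] Table 1.
-/

set_option autoImplicit false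
set_option linter.dupNamespace false

noncomputable section

open scoped Classical MatrixGroups ModularForm

open CongruenceSubgroup WeierstrassCurve Polynomial NumberField IsDedekindDomain
open Literature.NumberTheory.EllipticCurves Literature.NumberTheory.EllipticCurves.ModularForms
open Literature.NumberTheory.EllipticCurves.Greenberg1999 Literature.NumberTheory.EllipticCurves.GreenbergVatsal2000
open Literature.NumberTheory.EllipticCurves.Rank1Residual Literature.NumberTheory.EllipticCurves.Rank1Residual.Typed
open Literature.NumberTheory.EllipticCurves.CoatesLiTianZhai2015 Literature.NumberTheory.EllipticCurves.Zhai2016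
open Summit.BirchSwinnertonDyer.Rank1Residual Summit.BirchSwinnertonDyer.Rank1Residual.F1Sign2
open Summit.BirchSwinnertonDyer.Rank1Residual.X1.MuLambda Summit.BirchSwinnertonDyer.Rank1Residual.X5
open Summit.BirchSwinnertonDyer.BirchSwinnertonDyer.Theorems.Rank1ResidualX1Defs
open Summit.BirchSwinnertonDyer.BirchSwinnertonDyer.Theses.AlignedTransportAtTwo
open Summit.BirchSwinnertonDyer.BirchSwinnertonDyer.Theorems.AlignedTransportAtTwoTwistFamilySmallSeeds
open Summit.BirchSwinnertonDyer.BirchSwinnertonDyer.Theorems.AlignedTransportAtTwoTwistFamilyZhai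
open Summit.BirchSwinnertonDyer.BirchSwinnertonDyer.Theorems.AlignedTransportAtTwoTwistFamilyZhaiSplit
open Summit.BirchSwinnertonDyer.BirchSwinnertonDyer.Theorems.AlignedTransportAtTwoTwistFamilyZhaiExplicit
open Summit.BirchSwinnertonDyer.BirchSwinnertonDyer.Theorems.AlignedTransportAtTwoOffStratumRow2045b
open Summit.BirchSwinnertonDyer.BirchSwinnertonDyer.Theorems.TowerClass
open Summit.BirchSwinnertonDyer.BirchSwinnertonDyer.Theorems

namespace Summit.BirchSwinnertonDyer.BirchSwinnertonDyer.Theorems.AlignedTransportAtTwoTwistFamilyZhaiOddLevel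

/-! ## §1 Odd Manin constant from Abbes–Ullmo at odd level; the generic rows without `hν` -/

section Generic

variable (S : WeierstrassCurve ℚ) [S.IsElliptic] [S.IsGloballyMinimal] [NeZero (S.conductorNorm ℤ)]
  (W : WeierstrassCurve ℚ) [W.IsElliptic] [W.IsGloballyMinimal]

/-- **Zhai's standing assumption from print at odd level.** For an `X₀(N_S)`-optimality datum `Dt` of a globally minimal `S` (`IsOptimalDatum`:
`Λ_S = c·Λ_f`) with `N_S` odd, the Manin constant `Dt.c` is odd — Abbes–Ullmo 1996 Thm. A (`p ∤ N ⟹ p ∤ c`) at `p = 2`, named fact `hAU`.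
CONDITIONAL on `hAU`. [cite: AbbesUllmo1996, Thm. A] [cite: Zhai2016, arXiv:1409.0231v2 §1 standing assumption (TeX ll. 255–267)] -/
theorem not_two_dvd_c_of_abbesUllmo (hAU : abbesUllmo_not_dvd_maninConstant_of_not_dvd_level)
    (Dt : ModularParametrizationData S (S.conductorNorm ℤ)) (hopt : Zhai2021.IsOptimalDatum S Dt) (hodd : ¬ 2 ∣ S.conductorNorm ℤ) :
    ¬ (2 : ℤ) ∣ Dt.c :=
  hAU S Dt hopt 2 Nat.prime_two hodd

/-- **`BSD(W, 2)` on the whole Zhai sub-family of a certified seed of ODD conductor, `hν` discharged** (`…TwistFamilyZhai` §1 + Abbes–Ullmo):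
modulo PRINT⁹ {Kato 17.4 (1)(2) at `2`, modularity, Ω⁺/Ω⁻ units, Matsuno 4.2, Greenberg 4.1, GZK, Zhai 1.1, Abbes–Ullmo Thm. A} + cert {`BSD(S,2)`,
`TowerGapAtTwo S`} + displayed {optimality datum `Dt`, `ord₂ L^{alg}(S) = 0`}. CONDITIONAL; BSD is NOT proved.
[cite: Zhai2016, Thm. 1.1] [cite: AbbesUllmo1996, Thm. A] [cite: Kato2004Asterisque, Thm. 17.4 (1)(2) (p. 273)] [cite: Miller2011LMS, Def. 1.1] -/
theorem bsdp_two_twist_zhaiFamily_of_certified_seed_oddLevel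
    (hKato : ∀ (W : WeierstrassCurve ℚ) [W.IsElliptic] [W.IsGloballyMinimal] ⦃N : ℕ⦄ [NeZero N]
      (f : CuspForm (Gamma0 N) 2), kato_divisibility_allPrimes W 2 (f := f))
    (hmod : nonempty_modularParametrizationData) (hΩu : realPeriodRat_eq_unit_mul_plusPeriod_two)
    (hΩm : numRealComponents_mul_imaginaryPeriodRat_eq_unit_mul_minusPeriod_two) (hMat : matsuno2008_thm42_transport_two_lines)
    (hGr : Greenberg1999.thm41_charValue_rankZero_anyPrime) (hGZK : rank_eq_analyticRank_of_analyticRank_le_one)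
    (h11 : thm11_ordTwo_LAlg_twist_eq_zero') (hAU : abbesUllmo_not_dvd_maninConstant_of_not_dvd_level)
    (hordS : IsOrdinaryAt S 2) (htS : ∀ x : ℚ, ¬ HasRationalTwoTorsionX S x) (hbsdS : BSDp S 2) (hgapS : O1.TowerGapAtTwo S)
    (hodd : ¬ 2 ∣ S.conductorNorm ℤ)
    (Dt : ModularParametrizationData S (S.conductorNorm ℤ)) (hopt : Zhai2021.IsOptimalDatum S Dt)
    (hΔ : S.Δ < 0) (hL : ∃ x : ℚ, IsLAlg S x ∧ x ≠ 0 ∧ padicValRat 2 x = 0)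
    (F : Type) [Field F] [NumberField F] (hF : IsTwoDivisionField S F)
    (M : ℤ) (hsq : Squarefree M) (hM4 : M % 4 = 1) (hgcd : Int.gcd M (S.conductorNorm ℤ) = 1)
    (hne : M.natAbs.primeFactors.Nonempty) (hin : ∀ q ∈ M.natAbs.primeFactors, q ≠ 2 ∧ IsInertIn F q)
    {c : VariableChange ℚ} (hc : c • S.quadraticTwist (M : ℚ) = W) : BSDp W 2 :=
  bsdp_two_twist_zhaiFamily_of_certified_seed S W hKato hmod hΩu hΩm hMat hGr hGZK h11 hordS htS hbsdS hgapS Dt hopt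
    (not_two_dvd_c_of_abbesUllmo S hAU Dt hopt hodd) hΔ hL F hF M hsq hM4 hgcd hne hin hc

/-- **`BSD(W, 2)` on the SPLIT Zhai sub-family of a seed of ODD conductor, from PRINT only, `hν` discharged** (`…ZhaiSplit` §1 + Abbes–Ullmo):
modulo PRINT⁵ {Zhai 1.1, Zhai v2 1.2, Abbes–Ullmo Thm. A, modularity, GZK} + `BSDp S 2` + displayed {optimality datum `Dt`, `ord₂ L^{alg}(S) = 0`}.
CONDITIONAL; BSD is NOT proved. [cite: Zhai2016, Thm. 1.1 and arXiv:1409.0231v2 Thm. 1.2] [cite: AbbesUllmo1996, Thm. A] [cite: Miller2011LMS, Def. 1.1] -/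
theorem bsdp_two_twist_zhaiSplit_of_print_oddLevel
    (hmod : nonempty_modularParametrizationData) (hGZK : rank_eq_analyticRank_of_analyticRank_le_one)
    (h11 : thm11_ordTwo_LAlg_twist_eq_zero') (h12 : thm12v2_twoPartBSD_twist_of_split)
    (hAU : abbesUllmo_not_dvd_maninConstant_of_not_dvd_level) (hodd : ¬ 2 ∣ S.conductorNorm ℤ)
    (Dt : ModularParametrizationData S (S.conductorNorm ℤ)) (hopt : Zhai2021.IsOptimalDatum S Dt)
    (hΔ : S.Δ < 0) (htS : ∀ x : ℚ, ¬ HasRationalTwoTorsionX S x)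
    (hL : ∃ x : ℚ, IsLAlg S x ∧ x ≠ 0 ∧ padicValRat 2 x = 0)
    (F : Type) [Field F] [NumberField F] (hF : IsTwoDivisionField S F) (hbsdS : BSDp S 2)
    (M : ℤ) (hsq : Squarefree M) (hM4 : M % 4 = 1) (hgcd : Int.gcd M (S.conductorNorm ℤ) = 1)
    (hne : M.natAbs.primeFactors.Nonempty) (hin : ∀ q ∈ M.natAbs.primeFactors, q ≠ 2 ∧ IsInertIn F q)
    (hsplit : ∀ (K : Type) [Field K] [NumberField K], Module.finrank ℚ K = 2 → (∃ x : K, x ^ 2 = (M : K)) →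
      SatisfiesHeegnerHypothesis (S.conductorNorm ℤ) K)
    {c : VariableChange ℚ} (hc : c • S.quadraticTwist (M : ℚ) = W) : BSDp W 2 :=
  bsdp_two_twist_zhaiSplit_of_print S W hmod hGZK h11 h12 Dt hopt (not_two_dvd_c_of_abbesUllmo S hAU Dt hopt hodd) hΔ htS hL F hF hbsdS
    M hsq hM4 hgcd hne hin hsplit hc

end Generic

/-! ## §2 The five small seeds (all of odd conductor): the split rows with two displayed data -/

section SmallSeeds

variable (W : WeierstrassCurve ℚ) [W.IsElliptic] [W.IsGloballyMinimal]
  (hmod : nonempty_modularParametrizationData) (hGZK : rank_eq_analyticRank_of_analyticRank_le_one)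
  (hCM : bsdTriple_of_rank_le_one_of_conductor_lt)
  (h11 : thm11_ordTwo_LAlg_twist_eq_zero') (h12 : thm12v2_twoPartBSD_twist_of_split)
  (hAU : abbesUllmo_not_dvd_maninConstant_of_not_dvd_level)
  (F : Type) [Field F] [NumberField F] (M : ℤ)

include hmod hGZK hCM h11 h12 hAU in
/-- **`BSD(W, 2)` FROM PRINT for every minimal model of `1727a1^{(M)}`**, `M` Zhai-admissible with `11`, `157` split in `ℚ(√M)`, modulo PRINT⁶ {Zhai 1.1,
Zhai v2 1.2, Creutz–Miller 1.1, Abbes–Ullmo Thm. A, GZK, modularity} + displayed {`X₀(1727)`-optimality datum `Dt` of `1727a1`, `ord₂(L(1727a1,1)/Ω_∞) = 0`}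
(`1727` is odd). CONDITIONAL; BSD is NOT proved. [cite: Zhai2016, Thm. 1.1 and arXiv:1409.0231v2 Thm. 1.2] [cite: AbbesUllmo1996, Thm. A] [cite: CreutzMiller2012, Thm. 1.1] -/
theorem bsdp_two_twist_zhaiSplit_1727a1_oddLevel [NeZero (c1727a1.conductorNorm ℤ)]
    (Dt : ModularParametrizationData c1727a1 (c1727a1.conductorNorm ℤ)) (hopt : Zhai2021.IsOptimalDatum c1727a1 Dt)
    (hL : ∃ x : ℚ, IsLAlg c1727a1 x ∧ x ≠ 0 ∧ padicValRat 2 x = 0)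
    (hF : IsTwoDivisionField c1727a1 F) (hsq : Squarefree M) (hM4 : M % 4 = 1) (hgcd : Int.gcd M 1727 = 1)
    (hne : M.natAbs.primeFactors.Nonempty) (hin : ∀ q ∈ M.natAbs.primeFactors, q ≠ 2 ∧ IsInertIn F q)
    (hsplit : ∀ (K : Type) [Field K] [NumberField K], Module.finrank ℚ K = 2 → (∃ x : K, x ^ 2 = (M : K)) →
      SatisfiesHeegnerHypothesis 1727 K)
    {c : VariableChange ℚ} (hc : c • c1727a1.quadraticTwist (M : ℚ) = W) : BSDp W 2 :=
  bsdp_two_twist_zhaiSplit_1727a1 W hmod hGZK hCM h11 h12 F M Dt hopt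
    (not_two_dvd_c_of_abbesUllmo c1727a1 hAU Dt hopt (by rw [conductorNorm_1727a1]; decide)) hL hF hsq hM4 hgcd hne hin hsplit hc

include hmod hGZK hCM h11 h12 hAU in
/-- **`BSD(W, 2)` FROM PRINT for every minimal model of `2071a1^{(M)}`** (`M` Zhai-admissible, `19`, `109` split), modulo PRINT⁶ + {optimality datum,
`ord₂ L^{alg}(2071a1) = 0`} (`2071` odd). CONDITIONAL; BSD is NOT proved. [cite: Zhai2016, Thm. 1.1 and arXiv:1409.0231v2 Thm. 1.2] [cite: AbbesUllmo1996, Thm. A] -/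
theorem bsdp_two_twist_zhaiSplit_2071a1_oddLevel [NeZero (c2071a1.conductorNorm ℤ)]
    (Dt : ModularParametrizationData c2071a1 (c2071a1.conductorNorm ℤ)) (hopt : Zhai2021.IsOptimalDatum c2071a1 Dt)
    (hL : ∃ x : ℚ, IsLAlg c2071a1 x ∧ x ≠ 0 ∧ padicValRat 2 x = 0)
    (hF : IsTwoDivisionField c2071a1 F) (hsq : Squarefree M) (hM4 : M % 4 = 1) (hgcd : Int.gcd M 2071 = 1)
    (hne : M.natAbs.primeFactors.Nonempty) (hin : ∀ q ∈ M.natAbs.primeFactors, q ≠ 2 ∧ IsInertIn F q)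
    (hsplit : ∀ (K : Type) [Field K] [NumberField K], Module.finrank ℚ K = 2 → (∃ x : K, x ^ 2 = (M : K)) →
      SatisfiesHeegnerHypothesis 2071 K)
    {c : VariableChange ℚ} (hc : c • c2071a1.quadraticTwist (M : ℚ) = W) : BSDp W 2 :=
  bsdp_two_twist_zhaiSplit_2071a1 W hmod hGZK hCM h11 h12 F M Dt hopt
    (not_two_dvd_c_of_abbesUllmo c2071a1 hAU Dt hopt (by rw [conductorNorm_2071a1]; decide)) hL hF hsq hM4 hgcd hne hin hsplit hc

include hmod hGZK hCM h11 h12 hAU in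
/-- **`BSD(W, 2)` FROM PRINT for every minimal model of `4087a1^{(M)}`** (`M` Zhai-admissible, `61`, `67` split), modulo PRINT⁶ + {optimality datum,
`ord₂ L^{alg}(4087a1) = 0`} (`4087` odd). CONDITIONAL; BSD is NOT proved. [cite: Zhai2016, Thm. 1.1 and arXiv:1409.0231v2 Thm. 1.2] [cite: AbbesUllmo1996, Thm. A] -/
theorem bsdp_two_twist_zhaiSplit_4087a1_oddLevel [NeZero (c4087a1.conductorNorm ℤ)]
    (Dt : ModularParametrizationData c4087a1 (c4087a1.conductorNorm ℤ)) (hopt : Zhai2021.IsOptimalDatum c4087a1 Dt)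
    (hL : ∃ x : ℚ, IsLAlg c4087a1 x ∧ x ≠ 0 ∧ padicValRat 2 x = 0)
    (hF : IsTwoDivisionField c4087a1 F) (hsq : Squarefree M) (hM4 : M % 4 = 1) (hgcd : Int.gcd M 4087 = 1)
    (hne : M.natAbs.primeFactors.Nonempty) (hin : ∀ q ∈ M.natAbs.primeFactors, q ≠ 2 ∧ IsInertIn F q)
    (hsplit : ∀ (K : Type) [Field K] [NumberField K], Module.finrank ℚ K = 2 → (∃ x : K, x ^ 2 = (M : K)) →
      SatisfiesHeegnerHypothesis 4087 K)
    {c : VariableChange ℚ} (hc : c • c4087a1.quadraticTwist (M : ℚ) = W) : BSDp W 2 :=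
  bsdp_two_twist_zhaiSplit_4087a1 W hmod hGZK hCM h11 h12 F M Dt hopt
    (not_two_dvd_c_of_abbesUllmo c4087a1 hAU Dt hopt (by rw [conductorNorm_4087a1]; decide)) hL hF hsq hM4 hgcd hne hin hsplit hc

include hmod hGZK hCM h11 h12 hAU in
/-- **`BSD(W, 2)` FROM PRINT for every minimal model of `4087c1^{(M)}`** (`M` Zhai-admissible, `61`, `67` split), modulo PRINT⁶ + {optimality datum,
`ord₂ L^{alg}(4087c1) = 0`} (`4087` odd). CONDITIONAL; BSD is NOT proved. [cite: Zhai2016, Thm. 1.1 and arXiv:1409.0231v2 Thm. 1.2] [cite: AbbesUllmo1996, Thm. A] -/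
theorem bsdp_two_twist_zhaiSplit_4087c1_oddLevel [NeZero (c4087c1.conductorNorm ℤ)]
    (Dt : ModularParametrizationData c4087c1 (c4087c1.conductorNorm ℤ)) (hopt : Zhai2021.IsOptimalDatum c4087c1 Dt)
    (hL : ∃ x : ℚ, IsLAlg c4087c1 x ∧ x ≠ 0 ∧ padicValRat 2 x = 0)
    (hF : IsTwoDivisionField c4087c1 F) (hsq : Squarefree M) (hM4 : M % 4 = 1) (hgcd : Int.gcd M 4087 = 1)
    (hne : M.natAbs.primeFactors.Nonempty) (hin : ∀ q ∈ M.natAbs.primeFactors, q ≠ 2 ∧ IsInertIn F q)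
    (hsplit : ∀ (K : Type) [Field K] [NumberField K], Module.finrank ℚ K = 2 → (∃ x : K, x ^ 2 = (M : K)) →
      SatisfiesHeegnerHypothesis 4087 K)
    {c : VariableChange ℚ} (hc : c • c4087c1.quadraticTwist (M : ℚ) = W) : BSDp W 2 :=
  bsdp_two_twist_zhaiSplit_4087c1 W hmod hGZK hCM h11 h12 F M Dt hopt
    (not_two_dvd_c_of_abbesUllmo c4087c1 hAU Dt hopt (by rw [conductorNorm_4087c1]; decide)) hL hF hsq hM4 hgcd hne hin hsplit hc

include hmod hGZK hCM h11 h12 hAU in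
/-- **`BSD(W, 2)` FROM PRINT for every minimal model of `2045b1^{(M)}`** (`M` Zhai-admissible, `5`, `409` split), modulo PRINT⁶ + {optimality datum,
`ord₂ L^{alg}(2045b1) = 0`} (`2045` odd). CONDITIONAL; BSD is NOT proved. [cite: Zhai2016, Thm. 1.1 and arXiv:1409.0231v2 Thm. 1.2] [cite: AbbesUllmo1996, Thm. A] -/
theorem bsdp_two_twist_zhaiSplit_2045b1_oddLevel [NeZero (c2045b1.conductorNorm ℤ)]
    (Dt : ModularParametrizationData c2045b1 (c2045b1.conductorNorm ℤ)) (hopt : Zhai2021.IsOptimalDatum c2045b1 Dt)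
    (hL : ∃ x : ℚ, IsLAlg c2045b1 x ∧ x ≠ 0 ∧ padicValRat 2 x = 0)
    (hF : IsTwoDivisionField c2045b1 F) (hsq : Squarefree M) (hM4 : M % 4 = 1) (hgcd : Int.gcd M 2045 = 1)
    (hne : M.natAbs.primeFactors.Nonempty) (hin : ∀ q ∈ M.natAbs.primeFactors, q ≠ 2 ∧ IsInertIn F q)
    (hsplit : ∀ (K : Type) [Field K] [NumberField K], Module.finrank ℚ K = 2 → (∃ x : K, x ^ 2 = (M : K)) →
      SatisfiesHeegnerHypothesis 2045 K)
    {c : VariableChange ℚ} (hc : c • c2045b1.quadraticTwist (M : ℚ) = W) : BSDp W 2 :=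
  bsdp_two_twist_zhaiSplit_2045b1 W hmod hGZK hCM h11 h12 F M Dt hopt
    (not_two_dvd_c_of_abbesUllmo c2045b1 hAU Dt hopt (by rw [conductorNorm_2045b1]; decide)) hL hF hsq hM4 hgcd hne hin hsplit hc

end SmallSeeds

/-! ## §3 The explicit members of `1727a1` with two displayed data -/

section Explicit

variable (W : WeierstrassCurve ℚ) [W.IsElliptic] [W.IsGloballyMinimal]
  (hmod : nonempty_modularParametrizationData) (hGZK : rank_eq_analyticRank_of_analyticRank_le_one)
  (hCM : bsdTriple_of_rank_le_one_of_conductor_lt)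
  (h11 : thm11_ordTwo_LAlg_twist_eq_zero') (h12 : thm12v2_twoPartBSD_twist_of_split)
  (hAU : abbesUllmo_not_dvd_maninConstant_of_not_dvd_level)
  (F : Type) [Field F] [NumberField F]

include hmod hGZK hCM h11 h12 hAU in
/-- **`BSD(W, 2)` IN PRINT for every minimal model of `1727a1^{(37)}`**, modulo PRINT⁶ {Zhai 1.1, Zhai v2 1.2, Creutz–Miller 1.1, Abbes–Ullmo Thm. A,
GZK, modularity} + displayed {optimality datum `Dt` of `1727a1`, `ord₂(L(1727a1,1)/Ω_∞) = 0`}. CONDITIONAL; BSD is NOT proved.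
[cite: Zhai2016, Thm. 1.1 and arXiv:1409.0231v2 Thm. 1.2] [cite: AbbesUllmo1996, Thm. A] [cite: CreutzMiller2012, Thm. 1.1] [cite: Miller2011LMS, Def. 1.1] -/
theorem bsdp_two_twist_1727a1_37_oddLevel [NeZero (c1727a1.conductorNorm ℤ)]
    (Dt : ModularParametrizationData c1727a1 (c1727a1.conductorNorm ℤ)) (hopt : Zhai2021.IsOptimalDatum c1727a1 Dt)
    (hL : ∃ x : ℚ, IsLAlg c1727a1 x ∧ x ≠ 0 ∧ padicValRat 2 x = 0) (hF : IsTwoDivisionField c1727a1 F)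
    {c : VariableChange ℚ} (hc : c • c1727a1.quadraticTwist ((37 : ℤ) : ℚ) = W) : BSDp W 2 :=
  bsdp_two_twist_1727a1_37 W hmod hGZK hCM h11 h12 F Dt hopt
    (not_two_dvd_c_of_abbesUllmo c1727a1 hAU Dt hopt (by rw [conductorNorm_1727a1]; decide)) hL hF hc

include hmod hGZK hCM h11 h12 hAU in
/-- **`BSD(W, 2)` IN PRINT for every minimal model of `1727a1^{(93)}`**, modulo PRINT⁶ + the two displayed data of `1727a1`. CONDITIONAL; BSD is NOT proved.
[cite: Zhai2016, Thm. 1.1 and arXiv:1409.0231v2 Thm. 1.2] [cite: AbbesUllmo1996, Thm. A] [cite: CreutzMiller2012, Thm. 1.1] [cite: Miller2011LMS, Def. 1.1] -/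
theorem bsdp_two_twist_1727a1_93_oddLevel [NeZero (c1727a1.conductorNorm ℤ)]
    (Dt : ModularParametrizationData c1727a1 (c1727a1.conductorNorm ℤ)) (hopt : Zhai2021.IsOptimalDatum c1727a1 Dt)
    (hL : ∃ x : ℚ, IsLAlg c1727a1 x ∧ x ≠ 0 ∧ padicValRat 2 x = 0) (hF : IsTwoDivisionField c1727a1 F)
    {c : VariableChange ℚ} (hc : c • c1727a1.quadraticTwist ((93 : ℤ) : ℚ) = W) : BSDp W 2 :=
  bsdp_two_twist_1727a1_93 W hmod hGZK hCM h11 h12 F Dt hopt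
    (not_two_dvd_c_of_abbesUllmo c1727a1 hAU Dt hopt (by rw [conductorNorm_1727a1]; decide)) hL hF hc

include h11 hAU in
/-- **`r_an(W) = 0` IN PRINT for every minimal model of `1727a1^{(−3)}`** (conductor `15543`), modulo {Zhai 1.1, Abbes–Ullmo Thm. A} + the two displayed
data of `1727a1`. CONDITIONAL; BSD is NOT proved. [cite: Zhai2016, Thm. 1.1 (arXiv v2 ll. 273–279)] [cite: AbbesUllmo1996, Thm. A] -/
theorem analyticRank_eq_zero_twist_1727a1_neg3_oddLevel [NeZero (c1727a1.conductorNorm ℤ)]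
    (Dt : ModularParametrizationData c1727a1 (c1727a1.conductorNorm ℤ)) (hopt : Zhai2021.IsOptimalDatum c1727a1 Dt)
    (hL : ∃ x : ℚ, IsLAlg c1727a1 x ∧ x ≠ 0 ∧ padicValRat 2 x = 0) (hF : IsTwoDivisionField c1727a1 F)
    {c : VariableChange ℚ} (hc : c • c1727a1.quadraticTwist ((-3 : ℤ) : ℚ) = W) : W.analyticRank = 0 :=
  analyticRank_eq_zero_twist_1727a1_neg3 W h11 F Dt hopt
    (not_two_dvd_c_of_abbesUllmo c1727a1 hAU Dt hopt (by rw [conductorNorm_1727a1]; decide)) hL hF hc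

end Explicit

end Summit.BirchSwinnertonDyer.BirchSwinnertonDyer.Theorems.AlignedTransportAtTwoTwistFamilyZhaiOddLevel

end
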